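import Summits.QuantumFields.QCD.Theses.NestedDissectionSea

/-!
# Sketch — crux-ideate round 1, ideator 1, crux `CoerciveOfDilute` (stmt-QuantumFields-14759)

First lemmas of the two idea cards filed by this seat (planner-cruxidea-stmt-QuantumFields-14759-1-0):

* card `sea-pays-its-own-poles` — §1 the abstract MARKOV-BY-FACTORISATION inequality (proved):
  if a non-negative weight factorises as `W = X · R` with `X, R ≥ 0`, then the `W`-mass of `{X < δ}` is at
  most `δ · ∫ R`; applied with `X = σ_min` of the torus Schur complement onto the cell's internal separator
  (so that `1/X = ‖(D_T(m_f)⁻¹)_ΣΣ‖`, the torus quark propagator compressed to the separator) and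
  `R =` the rest of the phase-quenched weight, it says the phase-quenched probability of a
  near-singular TORUS-Schur separator is `≤ δ · E_pq‖(D_T⁻¹)_ΣΣ‖`-type quantities with NO density input;
  §3 the typed transfer `TorusSheetMoment` (C⁺), the wall transfer `WallTransfer`, the coarse/fine laws.
* card `two-regime-splice` — §2 the SPLICE lemma (proved, pure real analysis): a `k`-uniform power law on
  the coarse levels `t ∈ [t₁, 1]` and a fixed-cutoff power law with a constant polynomially large in `1/t₁`
  on all levels combine, for an event monotone in the level, into ONE power law on `(0, 1]` with exponent
  `α α₀ / (α + p)` and constant `max A B` — independent of `t₁`.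

Everything is stated over tree vocabulary (`wilsonDirac`, `wilsonCell`, `wilsonBox`, `halfCorner`, `halfSides`,
`childrenInterior`, `HasSingularSeparator`, `fermionDet`, `wilsonMeasure`, `QCDRegularisation`); the matrix norm
is Mathlib's `ℓ²` operator norm (`Matrix.Norms.L2Operator`). No `sorry`.
-/

noncomputable section

open scoped BigOperators Classical Matrix.Norms.L2Operator
open MeasureTheory Filter Matrix
open Literature.MathematicalPhysics.QuantumLattice Literature.MathematicalPhysics.QuantumFieldTheory
  Literature.Probability.LatticeModels

namespace Summit.QuantumFields.QCD.Cruxes.CoerciveOfDilute.SeaPaysPoles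

/-! ## §0 Vocabulary: the internal separator as a torus predicate; the two compressed propagators -/

section Vocabulary

variable {N : ℕ} [NeZero N]

/-- The internal separator `Σ` of the corner-`0` open box of sides `s` (the box minus its sixteen
children), as a predicate on the FULL Wilson index set of the torus (site, colour, spin). -/
def sheet (s : Fin 4 → ℕ) (p : TorusSite 4 N × Fin 3 × Fin 4) : Prop :=
  wilsonBox (0 : TorusSite 4 N) s p ∧ ∀ ε : Fin 4 → Bool, ¬ wilsonBox (halfCorner s ε) (halfSides s ε) p

/-- The TORUS quark propagator `D_T(μ)⁻¹` (full periodic `r = 1` Wilson–Dirac matrix of the torus,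
fundamental `SU(3)`) compressed to the internal separator of the corner-`0` box: `(D_T(μ)⁻¹)_ΣΣ`.
Its inverse is the Schur complement of the torus matrix onto `Σ`; the phase-quenched weight
`|det D_T(μ)|` factorises through its smallest singular value (card `sea-pays-its-own-poles`). -/
def torusSheetGreen (U : GaugeConfig 4 N (Matrix.specialUnitaryGroup (Fin 3) ℂ)) (μ : ℝ)
    (s : Fin 4 → ℕ) : Matrix {p // sheet (N := N) s p} {p // sheet (N := N) s p} ℂ :=
  (wilsonDirac (fundamentalRep (Fin 3)) U μ 1)⁻¹.toBlock (sheet s) (sheet s)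

/-- The DIRICHLET cell propagator compressed to the internal separator, `(D_c(μ)⁻¹)_ΣΣ` — the crux's own
object in propagator form (`hasSingularSeparator_iff_compressedInverse`, p110101). -/
def cellSheetGreen (U : GaugeConfig 4 N (Matrix.specialUnitaryGroup (Fin 3) ℂ)) (μ : ℝ)
    (s : Fin 4 → ℕ) :
    Matrix {p : {p // wilsonBox (0 : TorusSite 4 N) s p} // ¬ childrenInterior s p}
      {p : {p // wilsonBox (0 : TorusSite 4 N) s p} // ¬ childrenInterior s p} ℂ :=
  (wilsonCell U μ 0 s)⁻¹.toBlock (fun p => ¬ childrenInterior s p) (fun p => ¬ childrenInterior s p)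

omit [NeZero N] in
/-- `sheet s` is exactly the crux's internal separator `{p ∈ box | ¬ childrenInterior s p}` read on the ambient index. -/
theorem sheet_iff (s : Fin 4 → ℕ) (p : TorusSite 4 N × Fin 3 × Fin 4) :
    sheet (N := N) s p ↔ ∃ h : wilsonBox (0 : TorusSite 4 N) s p, ¬ childrenInterior s ⟨p, h⟩ := by
  simp only [sheet, childrenInterior, not_exists]
  constructor
  · rintro ⟨h, h'⟩; exact ⟨h, h'⟩
  · rintro ⟨h, h'⟩; exact ⟨h, h'⟩

end Vocabulary

/-! ## §1 First lemma of `sea-pays-its-own-poles`: Markov by factorisation (no density input) -/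

/-- **Markov by factorisation.** On any measure space, if `X, R ≥ 0` and `R`, `X·R` are integrable, then
for every `δ ≥ 0` the `X·R`-mass of the event `{X < δ}` is at most `δ · ∫ R`. With `X·R =` the
phase-quenched weight and `X = σ_min` of the torus Schur complement onto `Σ` this is
`P_pq(σ_min < δ) · Z_pq ≤ δ · ∫ R`, i.e. `P_pq(‖(D_T⁻¹)_ΣΣ‖ > 1/δ) ≤ δ · E_pq‖(D_T⁻¹)_ΣΣ‖`
with `E_pq‖(D_T⁻¹)_ΣΣ‖ = (∫ R)/Z_pq` FINITE for free — the sea determinant cancels the pole. [folklore] -/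
theorem weightedMass_lt_le_of_factorisation {Ω : Type*} [MeasurableSpace Ω] (μ : Measure Ω)
    {X R : Ω → ℝ} (hX : ∀ ω, 0 ≤ X ω) (hR : ∀ ω, 0 ≤ R ω) (hRi : Integrable R μ) {δ : ℝ}
    (hδ : 0 ≤ δ) :
    ∫ ω, (if X ω < δ then (1 : ℝ) else 0) * (X ω * R ω) ∂μ ≤ δ * ∫ ω, R ω ∂μ := by
  rw [← integral_const_mul]
  refine integral_mono_of_nonneg (Filter.Eventually.of_forall fun ω => ?_) (hRi.const_mul δ)
    (Filter.Eventually.of_forall fun ω => ?_)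
  · show (0 : ℝ) ≤ (if X ω < δ then (1 : ℝ) else 0) * (X ω * R ω)
    split_ifs
    · rw [one_mul]; exact mul_nonneg (hX ω) (hR ω)
    · rw [zero_mul]
  · show (if X ω < δ then (1 : ℝ) else 0) * (X ω * R ω) ≤ δ * R ω
    split_ifs with h
    · rw [one_mul]; exact mul_le_mul_of_nonneg_right h.le (hR ω)
    · rw [zero_mul]; exact mul_nonneg hδ (hR ω)

/-- **Ratio form** (the crux's phase-quenched probability is a ratio). Under the hypotheses above and a
positive normaliser `Z = ∫ X·R`, `P_{X·R}(X < δ) ≤ δ · (∫ R) / Z`. [folklore] -/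
theorem ratio_lt_le_of_factorisation {Ω : Type*} [MeasurableSpace Ω] (μ : Measure Ω)
    {X R : Ω → ℝ} (hX : ∀ ω, 0 ≤ X ω) (hR : ∀ ω, 0 ≤ R ω) (hRi : Integrable R μ) {δ : ℝ}
    (hδ : 0 ≤ δ) (hZ : 0 < ∫ ω, X ω * R ω ∂μ) :
    (∫ ω, (if X ω < δ then (1 : ℝ) else 0) * (X ω * R ω) ∂μ) / (∫ ω, X ω * R ω ∂μ) ≤
      δ * ((∫ ω, R ω ∂μ) / (∫ ω, X ω * R ω ∂μ)) := by
  rw [mul_div_assoc']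
  exact div_le_div_of_nonneg_right (weightedMass_lt_le_of_factorisation μ hX hR hRi hδ) hZ.le

/-- **Markov in ratio form** (used by `CoarseOfMomentAndTransfer`): for `F, wt ≥ 0` with `F·wt` integrable, a positive
level `M` and a positive normaliser, `P_wt(F > M) ≤ (1/M) · E_wt[F]`. [folklore] -/
theorem ratio_markov {Ω : Type*} [MeasurableSpace Ω] (μ : Measure Ω) {F wt : Ω → ℝ} (hF : ∀ ω, 0 ≤ F ω)
    (hwt : ∀ ω, 0 ≤ wt ω) (hint : Integrable (fun ω => F ω * wt ω) μ) {M : ℝ} (hM : 0 < M)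
    (hZ : 0 < ∫ ω, wt ω ∂μ) :
    (∫ ω, (if M < F ω then (1 : ℝ) else 0) * wt ω ∂μ) / (∫ ω, wt ω ∂μ) ≤
      (1 / M) * ((∫ ω, F ω * wt ω ∂μ) / (∫ ω, wt ω ∂μ)) := by
  rw [← mul_div_assoc]
  refine div_le_div_of_nonneg_right ?_ hZ.le
  rw [← integral_const_mul]
  refine integral_mono_of_nonneg (Filter.Eventually.of_forall fun ω => ?_) (hint.const_mul (1 / M))
    (Filter.Eventually.of_forall fun ω => ?_)
  · show (0 : ℝ) ≤ (if M < F ω then (1 : ℝ) else 0) * wt ω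
    split_ifs
    · rw [one_mul]; exact hwt ω
    · rw [zero_mul]
  · show (if M < F ω then (1 : ℝ) else 0) * wt ω ≤ 1 / M * (F ω * wt ω)
    split_ifs with h
    · rw [one_mul, ← mul_assoc]
      have h1 : (1 : ℝ) ≤ 1 / M * F ω := by
        rw [one_div, ← div_eq_inv_mul, le_div_iff₀ hM, one_mul]; exact h.le
      calc wt ω = 1 * wt ω := (one_mul _).symm
        _ ≤ (1 / M * F ω) * wt ω := mul_le_mul_of_nonneg_right h1 (hwt ω)
    · rw [zero_mul]; exact mul_nonneg (by positivity) (mul_nonneg (hF ω) (hwt ω))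

/-! ## §2 First lemma of `two-regime-splice`: the splice (pure real analysis) -/

/-- **The two-regime splice.** Let `P : ℝ → ℝ` be monotone (the probability of an event increasing in
the level `t`). Suppose a COARSE law `P t ≤ A t^α` on `[t₁, 1]` (`0 < t₁ ≤ 1`) and a FINE law
`P t ≤ B t₁^(−p) t^α₀` on `(0, 1]` whose constant is polynomially large in `1/t₁`. Then ONE power law holds
on all of `(0, 1]`: `P t ≤ max A B · t^α'` with `α' = min α (α α₀/(α + p))` — constant and exponent
independent of `t₁`. Proof: for `t ≥ t₁` use the coarse law and `t^α ≤ t^α'`; for `t < t₁` compare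
`t₁^α` with `t^α'`: if `t₁^α ≤ t^α'` then `P t ≤ P t₁ ≤ A t₁^α ≤ A t^α'`; otherwise `t^(α'/α) < t₁`, so
`t₁^(−p) ≤ t^(−p α'/α)` and the fine law gives `P t ≤ B t^(α₀ − p α'/α) ≤ B t^α'` (as
`α'(α + p) ≤ α α₀`). With `t₁ = a_k^γ` this is how a `k`-uniform law above resolution `a_k^γ` and a
fixed-cutoff Wegner bound with constants polynomial in `1/a_k` give clause (i) for all `t ∈ (0,1]`,
uniformly in `k`. [folklore] -/
theorem splice {P : ℝ → ℝ} {A B t₁ p α α₀ : ℝ} (hmono : Monotone P) (hA : 0 ≤ A) (hB : 0 ≤ B)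
    (ht₁ : 0 < t₁) (ht₁' : t₁ ≤ 1) (hp : 0 ≤ p) (hα : 0 < α) (hα₀ : 0 < α₀)
    (hcoarse : ∀ t, t₁ ≤ t → t ≤ 1 → P t ≤ A * t ^ α)
    (hfine : ∀ t, 0 < t → t ≤ 1 → P t ≤ B * t₁ ^ (-p) * t ^ α₀) :
    ∀ t, 0 < t → t ≤ 1 → P t ≤ max A B * t ^ (min α (α * α₀ / (α + p))) := by
  intro t ht0 ht1
  set α' : ℝ := min α (α * α₀ / (α + p)) with hα'def
  have hαp : 0 < α + p := by linarith
  have hα'pos : 0 < α' := lt_min hα (div_pos (mul_pos hα hα₀) hαp)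
  have hα'le : α' ≤ α := min_le_left _ _
  have hα'le2 : α' ≤ α * α₀ / (α + p) := min_le_right _ _
  have hkey : α' * (α + p) ≤ α * α₀ := (le_div_iff₀ hαp).mp hα'le2
  have htα' : 0 < t ^ α' := Real.rpow_pos_of_pos ht0 α'
  by_cases hcase : t₁ ≤ t
  · -- coarse regime
    calc P t ≤ A * t ^ α := hcoarse t hcase ht1
      _ ≤ A * t ^ α' := mul_le_mul_of_nonneg_left (Real.rpow_le_rpow_of_exponent_ge ht0 ht1 hα'le) hA
      _ ≤ max A B * t ^ α' := mul_le_mul_of_nonneg_right (le_max_left A B) htα'.le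
  · push Not at hcase
    by_cases hsub : t₁ ^ α ≤ t ^ α'
    · -- the coarse law at `t₁` already beats `t^α'`
      calc P t ≤ P t₁ := hmono hcase.le
        _ ≤ A * t₁ ^ α := hcoarse t₁ le_rfl ht₁'
        _ ≤ A * t ^ α' := mul_le_mul_of_nonneg_left hsub hA
        _ ≤ max A B * t ^ α' := mul_le_mul_of_nonneg_right (le_max_left A B) htα'.le
    · -- the fine law, with the polynomial loss absorbed
      push Not at hsub
      -- from `t^α' < t₁^α` get `t^(α'/α) < t₁`
      have hbase : t ^ (α' / α) < t₁ := by
        have h1 : (t ^ (α' / α)) ^ α = t ^ α' := by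
          rw [← Real.rpow_mul ht0.le]; congr 1; field_simp
        have h2 : (t ^ (α' / α)) ^ α < t₁ ^ α := by rw [h1]; exact hsub
        exact (Real.rpow_lt_rpow_iff (Real.rpow_nonneg ht0.le _) ht₁.le hα).mp h2
      -- hence `t₁^(-p) ≤ t^(-(p α'/α))`
      have hneg : t₁ ^ (-p) ≤ (t ^ (α' / α)) ^ (-p) :=
        Real.rpow_le_rpow_of_nonpos (Real.rpow_pos_of_pos ht0 _) hbase.le (by linarith)
      have hneg' : (t ^ (α' / α)) ^ (-p) = t ^ (-(p * α' / α)) := by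
        rw [← Real.rpow_mul ht0.le]; congr 1; ring
      -- the exponent bookkeeping `α' ≤ α₀ − p α'/α`
      have hexp : α' ≤ -(p * α' / α) + α₀ := by
        have hid : -(p * α' / α) + α₀ - α' = (α * α₀ - α' * (α + p)) / α := by
          field_simp; ring
        have : 0 ≤ -(p * α' / α) + α₀ - α' := by
          rw [hid]; exact div_nonneg (by linarith) hα.le
        linarith
      have htα₀ : 0 ≤ t ^ α₀ := Real.rpow_nonneg ht0.le α₀
      calc P t ≤ B * t₁ ^ (-p) * t ^ α₀ := hfine t ht0 ht1
        _ ≤ B * (t ^ (α' / α)) ^ (-p) * t ^ α₀ := by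
            apply mul_le_mul_of_nonneg_right _ htα₀
            exact mul_le_mul_of_nonneg_left hneg hB
        _ = B * t ^ (-(p * α' / α) + α₀) := by
            rw [hneg', mul_assoc, ← Real.rpow_add ht0]
        _ ≤ B * t ^ α' :=
            mul_le_mul_of_nonneg_left (Real.rpow_le_rpow_of_exponent_ge ht0 ht1 hexp) hB
        _ ≤ max A B * t ^ α' := mul_le_mul_of_nonneg_right (le_max_right A B) htα'.le

/-! ## §3 Typed statements of the line `sea-pays-its-own-poles` (Props; the research content) -/

/-- Local notation: the colour group `SU(3)`. -/
local notation "𝔾" => Matrix.specialUnitaryGroup (Fin 3) ℂ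

/-- **(M_Σ) `TorusSheetMoment` — the TRANSFER `C⁺` of card `sea-pays-its-own-poles`.** Along every
admissible regularisation on the physical branch and for every positive mass tuple and physical window
`ℓ`, there are `R, S₀, C` such that, eventually in `k`, on every odd torus of physical side `≥ R`, for
every roughly cubic corner-`0` window box with all sides `≥ S₀` and every flavour `f`, the
PHASE-QUENCHED MEAN OF THE OPERATOR NORM OF THE TORUS QUARK PROPAGATOR AT THE SEA MASS `m_f(k)`
COMPRESSED TO THE CELL'S INTERNAL SEPARATOR is at most `C · s₀`:
`E_pq ‖(D_T(m_f(k))⁻¹)_ΣΣ‖ ≤ C s₀`. Finite at fixed `k` with no input (the weight `∏_f |det D_T(m_f)|`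
contains the smallest singular value of the torus Schur complement onto `Σ`, whose inverse is the norm);
the content is the `k`-uniform SIZE, a first-moment budget (bulk `O(log s₀)` by the deterministic
high-mode cut, physical modes `O(Z_m)`, each artefact carrier `O(ρ) ≤ O(ρ_*) = O(a_k^{-1/2}) ≪ s₀`). -/
def TorusSheetMoment : Prop :=
  ∀ (Nf : ℕ) (reg : QCDRegularisation Nf), (Nf = 2 ∨ Nf = 3) → reg.HasMassScaling →
    (reg.scheme 0 0 0).HasAsymptoticScaling → Tendsto reg.mcrit atTop (nhds 0) →
    ∀ ℓ : ℝ, 0 < ℓ → ∀ m : Fin Nf → ℝ, (∀ f, 0 < m f) →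
    ∃ R : ℝ, 0 < R ∧ ∃ S₀ : ℕ, ∃ C : ℝ, 0 < C ∧ ∀ᶠ k : ℕ in atTop, ∀ S : ℕ, R ≤ reg.a k * (2 * S + 1) →
      let N : ℕ := 2 * S + 1
      let mq : Fin Nf → ℝ := fun f => reg.mcrit k + reg.a k * m f / reg.Zm k
      let wt : GaugeConfig 4 N 𝔾 → ℝ := fun U => ∏ f, ‖fermionDet (wilsonDirac (fundamentalRep (Fin 3)) U (mq f) 1)‖
      let E : (GaugeConfig 4 N 𝔾 → ℝ) → ℝ := fun F =>
        (∫ U, F U * wt U ∂(wilsonMeasure (d := 4) (L := N) (fundamentalRep (Fin 3)) (reg.β k))) /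
          (∫ U, wt U ∂(wilsonMeasure (d := 4) (L := N) (fundamentalRep (Fin 3)) (reg.β k)))
      ∀ s : Fin 4 → ℕ, (∀ i, 2 ≤ s i ∧ s i ≤ N ∧ (s i : ℝ) * reg.a k ≤ ℓ) → (∀ i, S₀ ≤ s i) →
        (∀ i j, s i ≤ 2 * s j) → ∀ f : Fin Nf,
        E (fun U => ‖torusSheetGreen U (mq f) s‖) ≤ C * s 0

/-- **(T) `WallTransfer`** — Dirichlet sheet propagator large ⇒ torus sheet propagator large, off an
exceptional event of polynomially small probability. Along every physical-branch admissible regularisation,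
positive tuple and window there are `R, S₀, C_w ≥ 1, γ > 0, γ' ≥ 0, B ≥ 0` such that eventually in `k`,
on large tori, for large roughly cubic window boxes, every flavour and every COARSE level
`t ∈ [a_k^γ, 1]`: the phase-quenched probability that the separator is `(t/s₀)`-singular (the crux's event)
WHILE the torus propagator compressed to the same separator stays below `s₀/(C_w t)` is `≤ B a_k^γ t^(−γ')`.
Mechanism: a sub-gap Dirichlet direction is torus-visible up to the second-order wall shift `≍ ‖K‖²θ`,
`θ =` its mass on the outer wall layer (`≍ ρ²/d³` for a size-`ρ` carrier at distance `d` from the wall,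
`≍ 16π²/s₀³` for box modes); the exceptional set is "a carrier within `d_k(t) = ρ_*(C s₀/t)^{1/3}` of the
outer wall", a fraction `≍ a_k^{1/6} t^{−1/3}` of carrier positions. -/
def WallTransfer : Prop :=
  ∀ (Nf : ℕ) (reg : QCDRegularisation Nf), (Nf = 2 ∨ Nf = 3) → reg.HasMassScaling →
    (reg.scheme 0 0 0).HasAsymptoticScaling → Tendsto reg.mcrit atTop (nhds 0) →
    ∀ ℓ : ℝ, 0 < ℓ → ∀ m : Fin Nf → ℝ, (∀ f, 0 < m f) →
    ∃ R : ℝ, 0 < R ∧ ∃ S₀ : ℕ, ∃ Cw : ℝ, 1 ≤ Cw ∧ ∃ γ : ℝ, 0 < γ ∧ ∃ γ' : ℝ, 0 ≤ γ' ∧ ∃ B : ℝ, 0 ≤ B ∧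
      ∀ᶠ k : ℕ in atTop, ∀ S : ℕ, R ≤ reg.a k * (2 * S + 1) →
      let N : ℕ := 2 * S + 1
      let mq : Fin Nf → ℝ := fun f => reg.mcrit k + reg.a k * m f / reg.Zm k
      let wt : GaugeConfig 4 N 𝔾 → ℝ := fun U => ∏ f, ‖fermionDet (wilsonDirac (fundamentalRep (Fin 3)) U (mq f) 1)‖
      let P : (GaugeConfig 4 N 𝔾 → Prop) → ℝ := fun Ev =>
        (∫ U, (if Ev U then (1 : ℝ) else 0) * wt U ∂(wilsonMeasure (d := 4) (L := N) (fundamentalRep (Fin 3)) (reg.β k))) /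
          (∫ U, wt U ∂(wilsonMeasure (d := 4) (L := N) (fundamentalRep (Fin 3)) (reg.β k)))
      ∀ s : Fin 4 → ℕ, (∀ i, 2 ≤ s i ∧ s i ≤ N ∧ (s i : ℝ) * reg.a k ≤ ℓ) → (∀ i, S₀ ≤ s i) →
        (∀ i j, s i ≤ 2 * s j) → ∀ f : Fin Nf, ∀ t : ℝ, reg.a k ^ γ ≤ t → t ≤ 1 →
        P (fun U => HasSingularSeparator U (mq f) s (t / s 0) ∧
            ‖torusSheetGreen U (mq f) s‖ ≤ (s 0 : ℝ) / (Cw * t)) ≤ B * reg.a k ^ γ * t ^ (-γ')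

/-- **`CoarseLaw`** — clause (i) on the COARSE levels only: `P_pq(HasSingularSeparator U m_f(k) s (t/s₀)) ≤
A t^α` for `t ∈ [a_k^γ, 1]`, large roughly cubic window boxes, along every physical-branch admissible
regularisation. (M_Σ) ∧ (T) give it with `α = 1` by Markov (§1) and a union bound. -/
def CoarseLaw : Prop :=
  ∀ (Nf : ℕ) (reg : QCDRegularisation Nf), (Nf = 2 ∨ Nf = 3) → reg.HasMassScaling →
    (reg.scheme 0 0 0).HasAsymptoticScaling → Tendsto reg.mcrit atTop (nhds 0) →
    ∀ ℓ : ℝ, 0 < ℓ → ∀ m : Fin Nf → ℝ, (∀ f, 0 < m f) →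
    ∃ R : ℝ, 0 < R ∧ ∃ S₀ : ℕ, ∃ γ : ℝ, 0 < γ ∧ ∃ A : ℝ, 0 < A ∧ ∃ α : ℝ, 0 < α ∧
      ∀ᶠ k : ℕ in atTop, ∀ S : ℕ, R ≤ reg.a k * (2 * S + 1) →
      let N : ℕ := 2 * S + 1
      let mq : Fin Nf → ℝ := fun f => reg.mcrit k + reg.a k * m f / reg.Zm k
      let wt : GaugeConfig 4 N 𝔾 → ℝ := fun U => ∏ f, ‖fermionDet (wilsonDirac (fundamentalRep (Fin 3)) U (mq f) 1)‖
      let P : (GaugeConfig 4 N 𝔾 → Prop) → ℝ := fun Ev =>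
        (∫ U, (if Ev U then (1 : ℝ) else 0) * wt U ∂(wilsonMeasure (d := 4) (L := N) (fundamentalRep (Fin 3)) (reg.β k))) /
          (∫ U, wt U ∂(wilsonMeasure (d := 4) (L := N) (fundamentalRep (Fin 3)) (reg.β k)))
      ∀ s : Fin 4 → ℕ, (∀ i, 2 ≤ s i ∧ s i ≤ N ∧ (s i : ℝ) * reg.a k ≤ ℓ) → (∀ i, S₀ ≤ s i) →
        (∀ i j, s i ≤ 2 * s j) → ∀ f : Fin Nf, ∀ t : ℝ, reg.a k ^ γ ≤ t → t ≤ 1 →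
        P (fun U => HasSingularSeparator U (mq f) s (t / s 0)) ≤ A * t ^ α

/-- **(F) `FineRegimeLaw`** — the FIXED-CUTOFF Wegner bound with polynomially lossy constants: clause (i)'s
event obeys `P_pq ≤ B a_k^(−p) t^α₀` for ALL `t ∈ (0,1]`, with `B, p, α₀` uniform (the constant may blow
up like a power of `1/a_k`, the exponent may not degrade). Single-link Haar / Erdős–Hasler smearing at
fixed `β_k` (conditional one-link density `≤ e^{12β_k}(2·24+1)` × Haar by Nikolskii; squared-gradient
floor `≥ 1/poly(s)`) is the intended engine — the mechanism of cards `haar-link-gradient`,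
`malliavin-wegner-collective-force` of crux 13901, hopeless for uniformity, sufficient here. -/
def FineRegimeLaw : Prop :=
  ∀ (Nf : ℕ) (reg : QCDRegularisation Nf), (Nf = 2 ∨ Nf = 3) → reg.HasMassScaling →
    (reg.scheme 0 0 0).HasAsymptoticScaling → Tendsto reg.mcrit atTop (nhds 0) →
    ∀ ℓ : ℝ, 0 < ℓ → ∀ m : Fin Nf → ℝ, (∀ f, 0 < m f) →
    ∃ R : ℝ, 0 < R ∧ ∃ S₀ : ℕ, ∃ p : ℝ, 0 ≤ p ∧ ∃ B : ℝ, 0 < B ∧ ∃ α₀ : ℝ, 0 < α₀ ∧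
      ∀ᶠ k : ℕ in atTop, ∀ S : ℕ, R ≤ reg.a k * (2 * S + 1) →
      let N : ℕ := 2 * S + 1
      let mq : Fin Nf → ℝ := fun f => reg.mcrit k + reg.a k * m f / reg.Zm k
      let wt : GaugeConfig 4 N 𝔾 → ℝ := fun U => ∏ f, ‖fermionDet (wilsonDirac (fundamentalRep (Fin 3)) U (mq f) 1)‖
      let P : (GaugeConfig 4 N 𝔾 → Prop) → ℝ := fun Ev =>
        (∫ U, (if Ev U then (1 : ℝ) else 0) * wt U ∂(wilsonMeasure (d := 4) (L := N) (fundamentalRep (Fin 3)) (reg.β k))) /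
          (∫ U, wt U ∂(wilsonMeasure (d := 4) (L := N) (fundamentalRep (Fin 3)) (reg.β k)))
      ∀ s : Fin 4 → ℕ, (∀ i, 2 ≤ s i ∧ s i ≤ N ∧ (s i : ℝ) * reg.a k ≤ ℓ) → (∀ i, S₀ ≤ s i) →
        (∀ i j, s i ≤ 2 * s j) → ∀ f : Fin Nf, ∀ t : ℝ, 0 < t → t ≤ 1 →
        P (fun U => HasSingularSeparator U (mq f) s (t / s 0)) ≤ B * (reg.a k) ^ (-p) * t ^ α₀

/-- **`SeparatorLawOnBranch`** — the conclusion of the registered `stub_separatorLawLarge` of the crux's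
built line, freed of its (pinned-dilute) hypothesis and read at zero threshold: clause (i) of
`CoerciveSea` on large roughly cubic window boxes, for ALL `t ∈ (0,1]`, along every physical-branch
admissible regularisation and every positive tuple. It implies `stub_separatorLawLarge` (weakening), hence
`CoerciveSea` with `stub_pinnedDilutionOnPhysicalBranch` (p108820) and `CoerciveOfDilute`
(`coerciveOfDilute_of_coerciveSea`; or directly `coerciveOfDilute_of_largeLeafWegnerLaw` on the branch). -/
def SeparatorLawOnBranch : Prop :=
  ∀ (Nf : ℕ) (reg : QCDRegularisation Nf), (Nf = 2 ∨ Nf = 3) → reg.HasMassScaling →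
    (reg.scheme 0 0 0).HasAsymptoticScaling → Tendsto reg.mcrit atTop (nhds 0) →
    ∀ ℓ : ℝ, 0 < ℓ → ∀ m : Fin Nf → ℝ, (∀ f, 0 < m f) →
    ∃ R : ℝ, 0 < R ∧ ∃ S₀ : ℕ, ∃ C : ℝ, 0 < C ∧ ∃ α : ℝ, 0 < α ∧
      ∀ᶠ k : ℕ in atTop, ∀ S : ℕ, R ≤ reg.a k * (2 * S + 1) →
      let N : ℕ := 2 * S + 1
      let mq : Fin Nf → ℝ := fun f => reg.mcrit k + reg.a k * m f / reg.Zm k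
      let wt : GaugeConfig 4 N 𝔾 → ℝ := fun U => ∏ f, ‖fermionDet (wilsonDirac (fundamentalRep (Fin 3)) U (mq f) 1)‖
      let P : (GaugeConfig 4 N 𝔾 → Prop) → ℝ := fun Ev =>
        (∫ U, (if Ev U then (1 : ℝ) else 0) * wt U ∂(wilsonMeasure (d := 4) (L := N) (fundamentalRep (Fin 3)) (reg.β k))) /
          (∫ U, wt U ∂(wilsonMeasure (d := 4) (L := N) (fundamentalRep (Fin 3)) (reg.β k)))
      ∀ s : Fin 4 → ℕ, (∀ i, 2 ≤ s i ∧ s i ≤ N ∧ (s i : ℝ) * reg.a k ≤ ℓ) → (∀ i, S₀ ≤ s i) →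
        (∀ i j, s i ≤ 2 * s j) → ∀ f : Fin Nf, ∀ t : ℝ, 0 < t → t ≤ 1 →
        P (fun U => HasSingularSeparator U (mq f) s (t / s 0)) ≤ C * t ^ α

/-- The composition the crux-plan stage would prove: Markov (§1) on (M_Σ), plus (T), gives `CoarseLaw`
with `α = 1`. (Named Prop; the proof is bookkeeping inside the quantifier shell.) -/
def CoarseOfMomentAndTransfer : Prop := TorusSheetMoment → WallTransfer → CoarseLaw

/-- The composition the crux-plan stage would prove from `splice` (§2): coarse + fine ⇒ the law on all
levels, with exponent `α α₀ γ₀/(γ₀ α + p)`-type bookkeeping (`t₁ = a_k^γ`, loss `t₁^{-p/γ}`) and the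
monotonicity of the crux's event in the level (`HasSingularSeparator.mono`). -/
def LawOfCoarseAndFine : Prop := CoarseLaw → FineRegimeLaw → SeparatorLawOnBranch

end Summit.QuantumFields.QCD.Cruxes.CoerciveOfDilute.SeaPaysPoles

end
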